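import Mathlib
import Summits.MatrixMultiplication.MatrixMultiplication.Theorems.HiddenToeplitzCornersHiddenCornerLemmaRStein

/-!
# Lower-triangular Toeplitz toolkit (hidden-corner lemma, crux stmt-MatrixMultiplication-10752)

Support file for crux item `stmt-MatrixMultiplication-10752`
(`Summit.MatrixMultiplication.MatrixMultiplication.Theses.HiddenToeplitzCorners.HiddenCornerLemmaR`),
line `frobenius-dual-short-syzygies`, stub `stub_mixedLaw` (normalisation of constant generators).

`Lo v := Matrix.of fun i j : Fin N => if j ≤ i then v (i - j) else 0` (written out verbatim; the
file introduces no definitions) is the lower-triangular Toeplitz matrix of `v`, i.e.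
multiplication by `v` in `ℂ[s]/(s^N)`.  Facts: `Lo v = ∑ v j • Z^j` (`hclR_lo_eq_sum`), hence `Lo`
commutes with the shift `Z` and with every other `Lo` (`hclR_commute_shift_lo`,
`hclR_commute_lo_lo`); `Lo v e₀ = v`, `Lo u v = Lo v u` (`hclR_lo_mulVec_e0`,
`hclR_lo_mulVec_comm`); if `u 0 ≠ 0` then `Lo u` is injective, a unit, and has an inverse vector
`Lo u a = e₀` (`hclR_lo_ker`, `hclR_lo_isUnit`, `hclR_lo_inv`); and every nonzero vector is
`Z^γ` applied to a vector with nonzero `0`-th entry (`hclR_lo_val_split`).  Used to normalise the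
constant generators of the mixed `(1,1)` class to `e_γ`, `e_ω` (`HiddenCornerLemmaRMixedOneOne`).
-/

set_option linter.dupNamespace false

namespace Summit.MatrixMultiplication.MatrixMultiplication.Theorems

open Matrix BigOperators Finset


/-- `Lo u = ∑ j, u j • Z^j`: a lower-triangular Toeplitz matrix is a polynomial in the shift. -/
theorem hclR_lo_eq_sum {N : ℕ} (u : Fin N → ℂ) :
    (Matrix.of fun i j : Fin N => if (j : ℕ) ≤ (i : ℕ) then
        u ⟨(i : ℕ) - j, Nat.lt_of_le_of_lt (Nat.sub_le _ _) i.2⟩ else 0) =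
      ∑ j : Fin N, u j • (Matrix.of fun i j : Fin N => if (i : ℕ) = (j : ℕ) + 1 then (1 : ℂ) else 0) ^ (j : ℕ) := by
  ext i k
  rw [Matrix.sum_apply]
  simp only [Matrix.smul_apply, hclR_shift_pow_apply, smul_eq_mul, mul_ite, mul_one, mul_zero,
    Matrix.of_apply]
  have hi := i.is_lt
  by_cases h : (k : ℕ) ≤ (i : ℕ)
  · rw [if_pos h, Finset.sum_eq_single ⟨(i : ℕ) - k, by omega⟩]
    · rw [if_pos (by simp only; omega)]
    · intro j _ hj
      rw [if_neg]
      intro h'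
      exact hj (Fin.ext (by simp only at h' ⊢; omega))
    · simp
  · rw [if_neg h]
    symm
    refine Finset.sum_eq_zero fun j _ => ?_
    rw [if_neg (by omega)]

/-- The shift commutes with lower-triangular Toeplitz matrices. -/
theorem hclR_commute_shift_lo {N : ℕ} (u : Fin N → ℂ) :
    Commute (Matrix.of fun i j : Fin N => if (i : ℕ) = (j : ℕ) + 1 then (1 : ℂ) else 0)
      (Matrix.of fun i j : Fin N => if (j : ℕ) ≤ (i : ℕ) then
        u ⟨(i : ℕ) - j, Nat.lt_of_le_of_lt (Nat.sub_le _ _) i.2⟩ else 0) := by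
  rw [hclR_lo_eq_sum]
  exact Commute.sum_right _ _ _ fun j _ => ((Commute.refl _).pow_right _).smul_right _

/-- Lower-triangular Toeplitz matrices commute with each other. -/
theorem hclR_commute_lo_lo {N : ℕ} (u v : Fin N → ℂ) :
    Commute (Matrix.of fun i j : Fin N => if (j : ℕ) ≤ (i : ℕ) then
        u ⟨(i : ℕ) - j, Nat.lt_of_le_of_lt (Nat.sub_le _ _) i.2⟩ else 0)
      (Matrix.of fun i j : Fin N => if (j : ℕ) ≤ (i : ℕ) then
        v ⟨(i : ℕ) - j, Nat.lt_of_le_of_lt (Nat.sub_le _ _) i.2⟩ else 0) := by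
  rw [hclR_lo_eq_sum u, hclR_lo_eq_sum v]
  exact Commute.sum_left _ _ _ fun i _ => Commute.sum_right _ _ _ fun j _ =>
    ((Commute.pow_pow_self _ _ _).smul_left _).smul_right _

/-- Column `0` of `Lo v` is `v`: `Lo v *ᵥ e₀ = v`. -/
theorem hclR_lo_mulVec_e0 {N : ℕ} (hN : 0 < N) (v : Fin N → ℂ) :
    (Matrix.of fun i j : Fin N => if (j : ℕ) ≤ (i : ℕ) then
        v ⟨(i : ℕ) - j, Nat.lt_of_le_of_lt (Nat.sub_le _ _) i.2⟩ else 0) *ᵥ Pi.single ⟨0, hN⟩ 1 = v := by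
  ext i
  simp only [Matrix.mulVec, dotProduct, Matrix.of_apply, Pi.single_apply, mul_ite, mul_one, mul_zero]
  rw [Finset.sum_eq_single ⟨0, hN⟩]
  · rw [if_pos rfl, if_pos (by simp)]
    congr 1
  · intro j _ hj; rw [if_neg hj]
  · simp

/-- `Lo v *ᵥ x` entrywise. -/
theorem hclR_lo_mulVec {N : ℕ} (v x : Fin N → ℂ) (n : Fin N) :
    ((Matrix.of fun i j : Fin N => if (j : ℕ) ≤ (i : ℕ) then
        v ⟨(i : ℕ) - j, Nat.lt_of_le_of_lt (Nat.sub_le _ _) i.2⟩ else 0) *ᵥ x) n =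
      ∑ j : Fin N, if (j : ℕ) ≤ (n : ℕ) then
        v ⟨(n : ℕ) - j, Nat.lt_of_le_of_lt (Nat.sub_le _ _) n.2⟩ * x j else 0 := by
  simp only [Matrix.mulVec, dotProduct, Matrix.of_apply]
  refine Finset.sum_congr rfl fun j _ => ?_
  split_ifs <;> simp

/-- Lower-triangular Toeplitz matrices act commutatively: `Lo u *ᵥ v = Lo v *ᵥ u`
(both are the truncated product `u · v` in `ℂ[s]/(s^N)`). -/
theorem hclR_lo_mulVec_comm {N : ℕ} (hN : 0 < N) (u v : Fin N → ℂ) :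
    (Matrix.of fun i j : Fin N => if (j : ℕ) ≤ (i : ℕ) then
        u ⟨(i : ℕ) - j, Nat.lt_of_le_of_lt (Nat.sub_le _ _) i.2⟩ else 0) *ᵥ v =
    (Matrix.of fun i j : Fin N => if (j : ℕ) ≤ (i : ℕ) then
        v ⟨(i : ℕ) - j, Nat.lt_of_le_of_lt (Nat.sub_le _ _) i.2⟩ else 0) *ᵥ u := by
  conv_lhs => rw [← hclR_lo_mulVec_e0 hN v]
  conv_rhs => rw [← hclR_lo_mulVec_e0 hN u]
  rw [Matrix.mulVec_mulVec, Matrix.mulVec_mulVec, (hclR_commute_lo_lo u v).eq]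

/-- If `u 0 ≠ 0` then `Lo u` has trivial kernel (triangular induction, via the Stein toolkit). -/
theorem hclR_lo_ker {N : ℕ} (hN : 0 < N) (u : Fin N → ℂ) (hu : u ⟨0, hN⟩ ≠ 0)
    (x : Fin N → ℂ)
    (hx : (Matrix.of fun i j : Fin N => if (j : ℕ) ≤ (i : ℕ) then
        u ⟨(i : ℕ) - j, Nat.lt_of_le_of_lt (Nat.sub_le _ _) i.2⟩ else 0) *ᵥ x = 0) : x = 0 := by
  set c : ℕ → ℂ := fun k => if h : k < N then x ⟨k, h⟩ else 0 with hc
  have hsum : ∑ k ∈ Finset.range N, c k •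
      ((Matrix.of fun i j : Fin N => if (i : ℕ) = (j : ℕ) + 1 then (1 : ℂ) else 0) ^ k *ᵥ u) = 0 := by
    rw [← hx]
    ext n
    rw [hclR_lo_mulVec, Finset.sum_apply, ← Fin.sum_univ_eq_sum_range]
    refine Finset.sum_congr rfl fun j _ => ?_
    rw [Pi.smul_apply, hclR_shift_pow_mulVec, smul_eq_mul]
    simp only [hc, dif_pos j.is_lt, Fin.eta]
    split_ifs <;> ring
  have hall := hclR_coeff_eq_zero_of_sum_smul_shift u c hN hu hsum
  funext k
  have := hall k k.is_lt
  simp only [hc, dif_pos k.is_lt, Fin.eta] at this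
  exact this

/-- If `u 0 ≠ 0` then `Lo u` is a unit. -/
theorem hclR_lo_isUnit {N : ℕ} (hN : 0 < N) (u : Fin N → ℂ) (hu : u ⟨0, hN⟩ ≠ 0) :
    IsUnit (Matrix.of fun i j : Fin N => if (j : ℕ) ≤ (i : ℕ) then
        u ⟨(i : ℕ) - j, Nat.lt_of_le_of_lt (Nat.sub_le _ _) i.2⟩ else 0) := by
  rw [← Matrix.mulVec_injective_iff_isUnit]
  intro x y hxy
  have h : (Matrix.of fun i j : Fin N => if (j : ℕ) ≤ (i : ℕ) then
      u ⟨(i : ℕ) - j, Nat.lt_of_le_of_lt (Nat.sub_le _ _) i.2⟩ else 0) *ᵥ (x - y) = 0 := by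
    rw [Matrix.mulVec_sub]; exact sub_eq_zero.mpr hxy
  exact sub_eq_zero.mp (hclR_lo_ker hN u hu (x - y) h)

/-- If `u 0 ≠ 0` there is an inverse vector: `Lo u *ᵥ a = e₀`. -/
theorem hclR_lo_inv :
    ∀ {N : ℕ} (hN : 0 < N) (u : Fin N → ℂ), u ⟨0, hN⟩ ≠ 0 →
      ∃ a : Fin N → ℂ, (Matrix.of fun i j : Fin N => if (j : ℕ) ≤ (i : ℕ) then
        u ⟨(i : ℕ) - j, Nat.lt_of_le_of_lt (Nat.sub_le _ _) i.2⟩ else 0) *ᵥ a = Pi.single ⟨0, hN⟩ 1 :=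
  fun hN u hu => Matrix.mulVec_surjective_iff_isUnit.mpr (hclR_lo_isUnit hN u hu) _

/-- Valuation split: a nonzero vector is the `γ`-fold shift of a vector with nonzero `0`-th entry,
where `γ` is its least nonzero index. -/
theorem hclR_lo_val_split {N : ℕ} (hN : 0 < N) (g : Fin N → ℂ) (hg : g ≠ 0) :
    ∃ (γ : ℕ) (gt : Fin N → ℂ), γ < N ∧ gt ⟨0, hN⟩ ≠ 0 ∧
      g = (Matrix.of fun i j : Fin N => if (i : ℕ) = (j : ℕ) + 1 then (1 : ℂ) else 0) ^ γ *ᵥ gt := by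
  classical
  have hex : ∃ i : Fin N, g i ≠ 0 := by
    by_contra hall; push Not at hall; exact hg (funext hall)
  obtain ⟨i₀, hi₀, hmin⟩ := (Finset.univ.filter fun i : Fin N => g i ≠ 0).exists_min_image
    (fun i => (i : ℕ)) (by obtain ⟨i, hi⟩ := hex; exact ⟨i, by simp [hi]⟩)
  rw [Finset.mem_filter] at hi₀
  refine ⟨(i₀ : ℕ), fun i => if h : (i : ℕ) + i₀ < N then g ⟨(i : ℕ) + i₀, h⟩ else 0, i₀.is_lt, ?_, ?_⟩
  · simp only [zero_add, dif_pos i₀.is_lt, Fin.eta]; exact hi₀.2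
  · funext i
    rw [hclR_shift_pow_mulVec]
    by_cases hle : (i₀ : ℕ) ≤ (i : ℕ)
    · rw [dif_pos hle]; simp only
      rw [dif_pos (by omega)]
      congr 1; ext; simp only; omega
    · rw [dif_neg hle]
      by_contra hne
      have := hmin i (by simp [hne])
      omega


end Summit.MatrixMultiplication.MatrixMultiplication.Theorems
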